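import Summits.BirchSwinnertonDyer.Rank1Residual.Partition.YanZhuImForm
import Summits.BirchSwinnertonDyer.Rank1Residual.Partition.Bsdp
import HarnessLib

/-!
# Row C2 (census row D1) through Yan–Zhu, J. Algebra 693 (2026) Thm. 5.11 (= arXiv Thm. 4.15 / Cor. 1.4):
# the BCS Cor. 1.3.1 binder FOLLOWS from the Yan–Zhu (Im)-form binder, and the row / headline re-keyed
# BY NAME (cell `bsd-litref`, tranche T2a, paper sub-dir `bcs25`, typer seat `bsd-litref-bcs25-ty`;
# the object named by reading desk C4, ROUND C4-R4-ADD (c)(ii), 2026-08-27)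

HONEST FRAMING (programme `BSD-LIT2PART-PROGRAMME-v1.md` §HONESTY, verbatim): «no tranche here
proves BSD; ARM L moves the LITERAL column of an r ≤ 1 census into the
kernel-proved-modulo-named-print column; ARM P changes what «named print» is worth.» THEOREMS
ONLY: no definition, no named fact is introduced, no `sorry`; every published theorem enters as one
of the tree's existing named Literature facts BY NAME and stays a hypothesis; nothing is asserted
about any particular curve; no census number moves here (a second door re-words cells, it moves
none; re-keying a flag is referee A's act). The partition files' own framing (cell `b2b-bsdres`)
applies verbatim: the residual classes are TYPED, not attempted; this is not "finishing BSD".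

## What this file proves

Row C2 of the partition (`RowC2 W p := ¬ W.HasCM ∧ 3 < p ∧ GoodOrd W p ∧ Irr W p ∧ BigIm W p`,
`Partition/Rows.lean`; census row D1 = the cells whose ONLY class-level cover is C2) is bound in
`Partition/Bsdp.lean` to Burungale–Castella–Skinner, IMRN 2025 Cor. 1.3.1 through the binder
`hBCS : BurungaleCastellaSkinner2025.cor131_padicValRat_bsd_rank_le_one` (`RowC2.bsdp`; 56 tree
files mention that fact, among them the H1 headline `bsdp_allCurves_of_not_corner_of_not_cornerF`
of `Partition/CornersAll.lean` and the consequence form `bsdp_or_residual`). The tree ALSO holds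
Yan–Zhu's theorem in its PRINTED (Im) form,
`YanZhu2026.thm415_padicValRat_bsd_rank_le_one_of_bigIm` (`Literature/…/YanZhu2026/PPartBSD.lean`:
every prime `p ≥ 3` of good ordinary reduction, `E[p]` irreducible, (Im) = `BigIm W p`,
`ord_{s=1} L(E,s) ≤ 1`, NO hypothesis on the conductor ⇒ `Ш` finite and
`L^{(r)}(E,1) = q · Reg · Ω` with `ord_p q = ord_p #Ш + ord_p ∏ c_ℓ − 2 ord_p #E(ℚ)_tors`), and its
door `Rank1Residual.bsdp_of_goodOrd_irr_bigIm` (`Rank1Residual/X10Proofs.lean`, every `p ≥ 3`).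

1. `RowC2.bcsCor131_of_yanZhuImForm` — **the BCS binder, exactly as the tree vendors it, is a
   CONSEQUENCE of the Yan–Zhu (Im)-form binder, exactly as the tree vendors it, with no further
   input**: the hypotheses of Cor. 1.3.1 as typed (`¬cm`, `3 < p`, good ordinary, (irr), (im),
   `r_an ≤ 1`, `Ш` finite) contain Yan–Zhu's (`3 ≤ p`, good, ordinary, (irr), (Im), `r_an ≤ 1`);
   the two conclusions differ by bookkeeping only — `Ω_E > 0` (`realPeriodRat_pos_holds`) and
   `Reg > 0` (`regulator_pos'`) turn `L^{(r)}(E,1) = q·Reg·Ω` into `L^{(r)}(E,1)/(Ω·Reg) = q`, and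
   `ord_p #E(ℚ)_tors = 0` under (irr) (`padicValNat_torsionOrder_eq_zero_of_irreducible`, Mazur)
   removes the torsion term. Hence EVERY consumer of `hBCS` is re-keyed to the refereed Yan–Zhu
   statement BY NAME — feed `RowC2.bcsCor131_of_yanZhuImForm hYZ` — with no consumer file edited
   (append-only tree). This is the REVERSE of the glue identity
   `MainConjecturesCoveredFactsDerivedIdentity.lean` (`yzThm415_of_publishedFacts_of_identityLink`,
   which derives T-YZ at `p > 3` FROM BCS Thm. 1.1.2 (b) + 1.2.4 (b) and others); the two together
   say the two vendored `p`-part statements agree on row C2, as the door's docstring states in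
   prose ("at `p ≥ 5` subsumed by BCS Cor. 1.3.1").
2. `RowC2.bsdp_of_yanZhu` — **C2 ⟹ `BSD(E,p)` WITHOUT `hBCS`** (binders: `hYZ` in the printed
   (Im) form and Gross–Zagier–Kolyvagin `hGZK` only; the row's `¬ W.HasCM` conjunct is unused by
   the mathematics but consumed by the BCS-shaped statement). This is the "3-line named re-route"
   of reading desk C4's ROUND C4-R4-ADD (c)(ii) / reader 1's ADDENDUM 5 §3 (b) (scratch
   `RowC2_bsdp_of_yanZhu.scratch.lean` 8f030b47, which used the door directly and therefore also
   modularity `hmod`; that shape is `RowC2.bsdp_of_yanZhu_of_door` below, kept for comparison).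
3. `bsdp_of_covered_of_yanZhuImForm`, `bsdp_or_residual_of_yanZhuImForm` and
   `bsdp_allCurves_of_not_corner_of_not_cornerF_of_yanZhuImForm` — the partition's consequence
   form and the H1 headline **granted THIRTEEN named facts instead of fourteen**: the BCS binder is
   DROPPED, the Yan–Zhu binder is taken in its printed (Im) form and serves BOTH row C2 (`p > 3`)
   and row C16 (`p = 3`; bridge `yanZhu_thm415_of_thm415_of_bigIm`, `Partition/YanZhuImForm.lean`).

What this does NOT say. Nothing about flags: on the BCS road row D1 carries the composite
`BCS25-IMC-equiv@BSTW+Wan15-Thm3@Fuj06(unpublished)+Hid04-gap` (referee C R258.4(ii)/R262.1;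
reading desk C4 ROUND C4-R4), on the Yan–Zhu road the cell flag of the fact as the desks word it
(`YZ26@3-BF-ERL-Ohta` on the fact's docstring; at `p ≥ 5` reading desk C4 ROUND C4-R4-ADD (c)
words the non-refereed residue as component (1) `IMC-equiv@BSTW` alone and offers referee A the
one-component re-key `YZ26@p≥5:IMC-equiv@BSTW`). Which flag a cell carries, and whether any cell
is re-keyed, is referee A's booking; this file only makes the Yan–Zhu road available BY NAME for
every existing consumer of the BCS binder. Imports: partition modules + Literature only (no
`Theses` module). Axioms: standard.

References: X. Yan, X. Zhu, *Iwasawa main conjecture for non-CM elliptic curves at good ordinary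
primes*, J. Algebra 693 (2026) 372–402 = arXiv:2412.20078, Thm. 1.2 (Im), Cor. 1.4, Thm. 5.11
(= arXiv v2 Thm. 4.15) [YanZhu2024MainConjNonCM]; A. Burungale, F. Castella, C. Skinner, *Base
change and Iwasawa main conjectures for GL₂*, IMRN 2025 rnaf082 = arXiv:2405.00270v2, Cor. 1.3.1
(p. 4), (irr_ℚ), (im) (p. 2) [BurungaleCastellaSkinner2025]; B. Mazur, *Modular curves and the
Eisenstein ideal*, IHÉS 47 (1977) III §5 [Mazur1977]; R. L. Miller, LMS J. Comput. Math. 14 (2011)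
Def. 1.1 [Miller2011LMS]; tree `Partition/Bsdp.lean`, `Partition/CornersAll.lean`,
`Partition/YanZhuImForm.lean`, `Rank1Residual/X10Proofs.lean`,
`Partition/MainConjecturesCoveredFactsDerivedIdentity.lean`; cell records
`pub/bsd-litref/bcs25/sheets/D-AUDIT-bcs25-r1-ADDENDUM-5.md` (61ebb6e22ac6ba84),
`D-AUDIT-bcs25-r2-add6.md` (5ecb7227a0898902), `pub-bsdpct/REFEREE.md` ROUND C4-R4-ADD.
-/

set_option autoImplicit false

noncomputable section

open scoped Classical

open WeierstrassCurve Literature.NumberTheory.EllipticCurves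
  Literature.NumberTheory.EllipticCurves.Rank1Residual Literature.NumberTheory.EllipticCurves.ModularForms

namespace Summit.BirchSwinnertonDyer.Rank1Residual

/-! ### §1 The BCS Cor. 1.3.1 binder is a consequence of the Yan–Zhu (Im)-form binder -/

/-- **Burungale–Castella–Skinner 2025 Cor. 1.3.1, as the tree vendors it
(`cor131_padicValRat_bsd_rank_le_one`: `¬cm`, `p > 3` good ordinary, (irr_ℚ), (im), `r_an ≤ 1`,
`Ш` finite ⟹ `L^{(r)}(E,1)/(Ω_E·Reg)` is a rational `q` with `ord_p q = ord_p #Ш + ord_p ∏ c_ℓ`),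
FOLLOWS from Yan–Zhu 2026 Thm. 5.11 / 4.15 in its printed (Im) form
(`thm415_padicValRat_bsd_rank_le_one_of_bigIm`: every `p ≥ 3` good ordinary, (irr), (Im),
`r_an ≤ 1`, no conductor hypothesis ⟹ `Ш` finite ∧ `L^{(r)}(E,1) = q·Reg·Ω_E` with
`ord_p q = ord_p #Ш + ord_p ∏ c_ℓ − 2·ord_p #E(ℚ)_tors`).** Pure bookkeeping in the kernel: the BCS
hypotheses imply Yan–Zhu's (`3 < p ⟹ 3 ≤ p`; `¬cm` and the finiteness binder are not needed);
`Ω_E > 0`, `Reg > 0` give the quotient form; the torsion term vanishes because `E[p]` irreducible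
forces `p ∤ #E(ℚ)_tors` (Mazur). So every consumer of the BCS binder `hBCS` is a consumer of the
refereed Yan–Zhu statement by name: feed `RowC2.bcsCor131_of_yanZhuImForm hYZ`.
[cite: YanZhu2024MainConjNonCM, Thm. 4.15 (§4.6) = Cor. 1.4 = J. Algebra 693 Thm. 5.11, hypothesis (Im)]
[cite: BurungaleCastellaSkinner2025, Cor. 1.3.1 (p. 4)] [cite: Mazur1977, Ch. III §5] -/
theorem RowC2.bcsCor131_of_yanZhuImForm
    (hYZ : YanZhu2026.thm415_padicValRat_bsd_rank_le_one_of_bigIm) :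
    BurungaleCastellaSkinner2025.cor131_padicValRat_bsd_rank_le_one := by
  intro W _ _ p _ _hcm hp hord hirr him hr _hfin
  obtain ⟨-, q, hq, hv⟩ := hYZ W p (le_of_lt hp) hord.1 hord.2 hirr him hr
  refine ⟨q, ?_, ?_⟩
  · -- `L^{(r)}(E,1) = q·Reg·Ω` ⟹ `L^{(r)}(E,1)/(Ω·Reg) = q`, the denominators being positive reals
    have hΩ : (W.realPeriodRat : ℂ) ≠ 0 := by exact_mod_cast W.realPeriodRat_pos_holds.ne'
    have hR : (W.regulator : ℂ) ≠ 0 := by exact_mod_cast W.regulator_pos'.ne'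
    have hden : ((W.realPeriodRat * W.regulator : ℝ) : ℂ) ≠ 0 := by
      push_cast
      exact mul_ne_zero hΩ hR
    rw [div_eq_iff hden, hq]
    push_cast
    ring
  · -- valuations: the torsion term is zero under (irr)
    rw [hv, padicValNat_torsionOrder_eq_zero_of_irreducible (hirr := hirr)]
    push_cast
    ring

/-! ### §2 Row C2 ⟹ `BSD(E,p)` through Yan–Zhu, by name -/

section Curve

variable {W : WeierstrassCurve ℚ} [W.IsElliptic] [W.IsGloballyMinimal] {p : ℕ} [Fact p.Prime]

/-- **C2 ⟹ `BSD(E,p)` WITHOUT the BCS binder**: Yan–Zhu 2026 Thm. 5.11 / 4.15 in its printed (Im)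
form (`hYZ`) and Gross–Zagier–Kolyvagin (`hGZK`), through the row's existing door `RowC2.bsdp` fed
with `RowC2.bcsCor131_of_yanZhuImForm hYZ`. The named re-route of reading desk C4, ROUND C4-R4-ADD
(c)(ii): every cell of partition row C2 (census row D1) with analytic rank `≤ 1` is closed to
Miller's `BSD(E,p)` on the Yan–Zhu road; which flag the cell then carries is referee A's booking.
[cite: YanZhu2024MainConjNonCM, Thm. 4.15 (§4.6) = Cor. 1.4, hypothesis (Im)] [cite: Miller2011LMS, Def. 1.1] -/
theorem RowC2.bsdp_of_yanZhu (hYZ : YanZhu2026.thm415_padicValRat_bsd_rank_le_one_of_bigIm)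
    (hGZK : rank_eq_analyticRank_of_analyticRank_le_one) (hr : W.analyticRank ≤ 1)
    (h : RowC2 W p) : BSDp W p :=
  RowC2.bsdp (RowC2.bcsCor131_of_yanZhuImForm hYZ) hGZK hr h

/-- The same conclusion through the Yan–Zhu door `Rank1Residual.bsdp_of_goodOrd_irr_bigIm` directly
(binder for binder from the row predicate: `3 < p ⟹ 3 ≤ p`, good ordinary, (irr), (Im); the
`¬ W.HasCM` conjunct unused), with modularity `hmod` as that door takes it — reader 1's scratch
shape (D-AUDIT-bcs25-r1 ADDENDUM 5 §3 (b)), kept beside `RowC2.bsdp_of_yanZhu` for comparison.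
[cite: YanZhu2024MainConjNonCM, Thm. 4.15 (§4.6) = Cor. 1.4, hypothesis (Im)] -/
theorem RowC2.bsdp_of_yanZhu_of_door (hYZ : YanZhu2026.thm415_padicValRat_bsd_rank_le_one_of_bigIm)
    (hGZK : rank_eq_analyticRank_of_analyticRank_le_one) (hmod : hasEntireLFunction_rat)
    (hr : W.analyticRank ≤ 1) (h : RowC2 W p) : BSDp W p :=
  bsdp_of_goodOrd_irr_bigIm hYZ hGZK hmod p (le_of_lt h.2.1) h.2.2.1 h.2.2.2.1 h.2.2.2.2 hr

/-! ### §3 The partition's consequence form and the H1 headline granted THIRTEEN named facts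
(BCS binder dropped; Yan–Zhu in printed (Im) form serves rows C2 and C16) -/

/-- **Covered ⟹ `BSD(E,p)` granted thirteen named facts** — `bsdp_of_covered` (`Partition/Bsdp.lean`)
with the BCS binder supplied by `RowC2.bcsCor131_of_yanZhuImForm hYZ` and the row-C16 special-case
Yan–Zhu binder by `yanZhu_thm415_of_thm415_of_bigIm hYZ`, both from the ONE printed (Im)-form
binder `hYZ`. [cite: YanZhu2024MainConjNonCM, Thm. 4.15 (§4.6) = Cor. 1.4, hypothesis (Im)] -/
theorem bsdp_of_covered_of_yanZhuImForm (hSk : Skinner2016.thmC_padicValRat_bsd_rank_zero)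
    (hJSW : JetchevSkinnerWan2017.thm121_padicValRat_bsd_rank_one)
    (hCGS : CastellaGrossiSkinner2025.thmD_padicValRat_bsd_rank_le_one)
    (hGV : GreenbergVatsal2000.thm13_charIdeal_eq_of_gvPar) (hGr : greenberg_charValue_rankZero)
    (hmod : hasEntireLFunction_rat) (hmodP : nonempty_modularParametrizationData)
    (hGZK : rank_eq_analyticRank_of_analyticRank_le_one)
    (hCM : bsdTriple_of_hasCM_of_L_one_ne_zero) (hKob : Kobayashi2013.cor14_bsdp_of_cm_rank_one)
    (hYZ : YanZhu2026.thm415_padicValRat_bsd_rank_le_one_of_bigIm)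
    (hW20 : Wuthrich2014.lemma20_surjective_threeAdic_of_semistable)
    (hLLT : LiLiuTian2024.thm11_bsdp_of_cm_rank_one)
    (hr : W.analyticRank ≤ 1) (h : Covered W p) : BSDp W p :=
  bsdp_of_covered hSk (RowC2.bcsCor131_of_yanZhuImForm hYZ) hJSW hCGS hGV hGr hmod hmodP hGZK hCM hKob
    (yanZhu_thm415_of_thm415_of_bigIm hYZ) hW20 hLLT hr h

/-- **The partition lemma, consequence form, granted thirteen named facts**: every pair `(E, p)` of
analytic rank `≤ 1` satisfies `BSD(E,p)` OR lies in a residual class — `bsdp_or_residual`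
(`Partition/Bsdp.lean`) without the BCS binder, Yan–Zhu in printed (Im) form.
[cite: YanZhu2024MainConjNonCM, Thm. 4.15 (§4.6) = Cor. 1.4, hypothesis (Im)] -/
theorem bsdp_or_residual_of_yanZhuImForm (hSk : Skinner2016.thmC_padicValRat_bsd_rank_zero)
    (hJSW : JetchevSkinnerWan2017.thm121_padicValRat_bsd_rank_one)
    (hCGS : CastellaGrossiSkinner2025.thmD_padicValRat_bsd_rank_le_one)
    (hGV : GreenbergVatsal2000.thm13_charIdeal_eq_of_gvPar) (hGr : greenberg_charValue_rankZero)
    (hmod : hasEntireLFunction_rat) (hmodP : nonempty_modularParametrizationData)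
    (hGZK : rank_eq_analyticRank_of_analyticRank_le_one)
    (hCM : bsdTriple_of_hasCM_of_L_one_ne_zero) (hKob : Kobayashi2013.cor14_bsdp_of_cm_rank_one)
    (hYZ : YanZhu2026.thm415_padicValRat_bsd_rank_le_one_of_bigIm)
    (hW20 : Wuthrich2014.lemma20_surjective_threeAdic_of_semistable)
    (hLLT : LiLiuTian2024.thm11_bsdp_of_cm_rank_one)
    (hr : W.analyticRank ≤ 1) : BSDp W p ∨ Residual W p :=
  bsdp_or_residual hSk (RowC2.bcsCor131_of_yanZhuImForm hYZ) hJSW hCGS hGV hGr hmod hmodP hGZK hCM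
    hKob (yanZhu_thm415_of_thm415_of_bigIm hYZ) hW20 hLLT hr

/-- **The H1 headline granted thirteen named facts.** Identical to
`bsdp_allCurves_of_not_corner_of_not_cornerF` (`Partition/CornersAll.lean`: `BSD(E,p)` for every
analytic-rank `≤ 1` curve on the domain "CM, or `p` odd with `p` good or (`p` multiplicative and
`r = 0`)" outside the eight non-CM corners and the CM corner `CornerF`) except that the BCS binder
`hBCS` is ABSENT — supplied in the kernel by `RowC2.bcsCor131_of_yanZhuImForm hYZ` — and the
Yan–Zhu binder is the printed (Im) form (`bsdp_allCurves_of_not_corner_of_not_cornerF_of_imForm`,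
`Partition/YanZhuImForm.lean`). [cite: YanZhu2024MainConjNonCM, Thm. 4.15 (§4.6) = Cor. 1.4, hypothesis (Im)] -/
theorem bsdp_allCurves_of_not_corner_of_not_cornerF_of_yanZhuImForm
    (hSk : Skinner2016.thmC_padicValRat_bsd_rank_zero)
    (hJSW : JetchevSkinnerWan2017.thm121_padicValRat_bsd_rank_one)
    (hCGS : CastellaGrossiSkinner2025.thmD_padicValRat_bsd_rank_le_one)
    (hGV : GreenbergVatsal2000.thm13_charIdeal_eq_of_gvPar) (hGr : greenberg_charValue_rankZero)
    (hmod : hasEntireLFunction_rat) (hmodP : nonempty_modularParametrizationData)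
    (hGZK : rank_eq_analyticRank_of_analyticRank_le_one)
    (hCM : bsdTriple_of_hasCM_of_L_one_ne_zero) (hKob : Kobayashi2013.cor14_bsdp_of_cm_rank_one)
    (hYZ : YanZhu2026.thm415_padicValRat_bsd_rank_le_one_of_bigIm)
    (hW20 : Wuthrich2014.lemma20_surjective_threeAdic_of_semistable)
    (hLLT : LiLiuTian2024.thm11_bsdp_of_cm_rank_one)
    (hr : W.analyticRank ≤ 1)
    (hdom : W.HasCM ∨ (p ≠ 2 ∧ (Good W p ∨ (Mult W p ∧ W.analyticRank = 0))))
    (hA : ¬ W.HasCM → ¬ ClassX1 W p ∧ ¬ ClassX9 W p ∧ ¬ (ClassX10 W p ∧ ¬ Surj W p) ∧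
      ¬ (ClassX6 W p ∧ W.analyticRank = 0) ∧ ¬ ClassX7 W p ∧ ¬ ClassX8 W p ∧
      ¬ ClassX11a W p ∧ ¬ ClassX2 W p)
    (hF : W.HasCM → ¬ CornerF W p) : BSDp W p :=
  bsdp_allCurves_of_not_corner_of_not_cornerF_of_imForm hSk (RowC2.bcsCor131_of_yanZhuImForm hYZ)
    hJSW hCGS hGV hGr hmod hmodP hGZK hCM hKob hYZ hW20 hLLT hr hdom hA hF

end Curve

end Summit.BirchSwinnertonDyer.Rank1Residual

end
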